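import Literature.NumberTheory.Rogawski1990.ArchSingularUniversalPinRatioOfLocalData   -- ★ p844463 U5 `exists_universalPinRatio_of_localData`
import Literature.NumberTheory.Weil1964.UnitaryArchSingularCentralizerLocalFrameIso    -- ★ p844497 U3-local-iso `exists_continuousMulEquiv_localFrame`, `isHaarMeasure_map_localFrame`, `map_localFrame_apply_univ`
import Literature.NumberTheory.Rogawski1990.ArchStableTorusOrbitalWallSingularTerms    -- ★ `isCompact_centralizer_circleDiagonal_comp_of_pos`
import Literature.NumberTheory.Automorphic.ArchStableClassRegularTorus                -- ★ `im_embedding_diagonal_eq_zero`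
import HarnessLib

/-!
# (U) FROM BLOCK DATA: the universal pin ratio `K = (V₂ V₁) ^ #{complex places}` once the block top-form measures factor over the places, the compact blocks have
# top-form volumes `V₂` (`U(2)`) and `V₁` (`U(1)`), and the noncompact local frame measures are `V₂V₁ ×` the pinned transports («(U)-ROAD» U5, block form; Rogawski 1990 §1.7, §3.8, §8.2, §14.5)

Topic `NumberTheory/Rogawski1990`; namespace `Literature.NumberTheory.Rogawski1990`.  THEOREMS ONLY (no `def`, no instance, no notation, no axiom, no named fact, no `sorry`).
Cell `pub/hodgecm-mathlib`, ENGINE T1 (crux H413 = `stmt-HodgeConjecture-24833`, supports-only); the (U) road (LEAD F0P3a-plan (g10) T9-32 (4) ∕ T9-34 (2); MEMO «(U)-ROAD v0»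
F0P3-p03 (g11) 0f8ca2f389d5ab6c).  Count-neutral; HONEST LABEL: HC_CM is proved only modulo the printed citations until rung 0 closes; pays nothing by itself — it rewrites
hypothesis (HC) of ★ U5 `exists_universalPinRatio_of_localData` («the local frame measure at a compact wall place is Haar of mass `M`») in BLOCK currency, the currency of
the volume computation (b3): «on a COMPACT `U(σ_w H)(ℂ)` the per-place block measure `μ2 H w` (resp. `μ1 H w`) is Haar of total mass `V₂` (resp. `V₁`)», `M := V₂ V₁`.
The bridge is ★ U3-local-iso: the local frame map is an isomorphism of topological groups `U(σ_w H_a)(ℂ) × U(σ_w H_b)(ℂ) ≃ₜ* Z(γ_w)`, and `Z(γ_w)` IS compact at a compact wall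
place (★ `isCompact_centralizer_circleDiagonal_comp_of_pos`), so both blocks are compact there, the frame measure is Haar (★ `isHaarMeasure_map_localFrame`) and its mass is
`V₂ V₁` (★ `map_localFrame_apply_univ`).  What remains for (U) UNCONDITIONALLY after this file: (U2) `hfac2 ∕ hfac1` (A-p06 (g28) `map_archPiEquivCM_archTopFormHaar`),
the two volumes `hvol2 ∕ hvol1` (print: `vol(U(2))`, `vol(U(1))` for `|ω_std|` [Rogawski1990 §14.5; Macdonald1980]), and (HN) (the printed sign relation `c_{H′} = −c_H`,
§8.2 p. 118, in top-form currency — U4).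

## References
* [Rogawski1990] J. D. Rogawski, *Automorphic Representations of Unitary Groups in Three Variables*, Ann. of Math. Stud. 123 (1990), §1.7 p. 6; §3.8 Prop. 3.8.1 (a) p. 27;
  §8.2 pp. 117–120; §14.5 pp. 238–239.
* [DeitmarEchterhoff2014] A. Deitmar, S. Echterhoff, *Principles of Harmonic Analysis*, 2nd ed. (2014), Thm. 1.5.3; §1.3.
* [BorelJacquet1979] A. Borel, H. Jacquet, *Automorphic forms and automorphic representations*, PSPM 33.1 (1979), §4.1.
-/

set_option autoImplicit false

noncomputable section

open MeasureTheory Measure Filter Topology NumberField NumberField.InfinitePlace NumberField.mixedEmbedding Equiv Function Set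
open Literature.MeasureTheory.Group Literature.NumberTheory.Automorphic
open Literature.NumberTheory.Automorphic.UnitaryGroup hiding hermForm
open Literature.LinearAlgebra.Matrix
open Literature.NumberTheory.Weil1964 Literature.NumberTheory.Weil1964.UnitaryArchTopForm
open scoped Matrix MatrixGroups Matrix.Norms.Operator ContDiff NNReal ENNReal

namespace Literature.NumberTheory.Rogawski1990

/-- A factor of a compact product with nonempty cofactor is compact. [folklore] -/
private theorem compactSpace_of_prod_left {X Y : Type*} [TopologicalSpace X] [TopologicalSpace Y] [Nonempty Y] [CompactSpace (X × Y)] : CompactSpace X := by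
  refine ⟨?_⟩
  have h := isCompact_univ.image (continuous_fst : Continuous (Prod.fst : X × Y → X))
  rwa [Set.image_univ, Set.range_eq_univ.mpr Prod.fst_surjective] at h

/-- A factor of a compact product with nonempty cofactor is compact. [folklore] -/
private theorem compactSpace_of_prod_right {X Y : Type*} [TopologicalSpace X] [TopologicalSpace Y] [Nonempty X] [CompactSpace (X × Y)] : CompactSpace Y := by
  refine ⟨?_⟩
  have h := isCompact_univ.image (continuous_snd : Continuous (Prod.snd : X × Y → Y))
  rwa [Set.image_univ, Set.range_eq_univ.mpr Prod.snd_surjective] at h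

variable (L : Type) [Field L] [NumberField L] [IsCMField L]

open scoped Classical in
/-- **(U) FROM BLOCK DATA.**  As ★ `exists_universalPinRatio_of_localData`, with hypothesis (HC) replaced by the block volumes: if on every COMPACT `U(σ_w H)(ℂ)` (`H`
hermitian invertible, `2 × 2` resp. `1 × 1`) the per-place block measure `μ2 H w` (resp. `μ1 H w`) is a Haar measure of total mass `V₂` (resp. `V₁`), and (HN) holds with the
constant `V₂ V₁`, then (U) holds with `K := (V₂ V₁) ^ #{w complex}`.  (At a compact wall place `Z(γ_w)` is compact, ★ `isCompact_centralizer_circleDiagonal_comp_of_pos`, and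
isomorphic as a topological group to `U(σ_w H_a)(ℂ) × U(σ_w H_b)(ℂ)` by ★ `exists_continuousMulEquiv_localFrame`, so both blocks are compact, the local frame measure is Haar,
★ `isHaarMeasure_map_localFrame`, of mass `V₂ V₁`, ★ `map_localFrame_apply_univ`.)
[cite: Rogawski1990, §1.7 p. 6; §3.8 Prop. 3.8.1 (a) p. 27; §8.2 pp. 117–120; §14.5 pp. 238–239] [cite: DeitmarEchterhoff2014, Thm. 1.5.3; §1.3] [cite: BorelJacquet1979, §4.1] -/
theorem exists_universalPinRatio_of_blockData [MeasurableSpace (GL (Fin 3) ℂ)] [BorelSpace (GL (Fin 3) ℂ)]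
    [MeasurableSpace (GL (Fin 2) ℂ)] [BorelSpace (GL (Fin 2) ℂ)] [MeasurableSpace (GL (Fin 1) ℂ)] [BorelSpace (GL (Fin 1) ℂ)]
    (α : Fin 3 → L) (hα : ∀ i, α i ≠ 0) (hherm : ∀ i, (IsCMField.complexConj L (α i) : L) = α i)
    [MeasurableSpace (arch (↥(maximalRealSubfield L)) L (IsCMField.complexConj L) 3 (Matrix.diagonal α))]
    [BorelSpace (arch (↥(maximalRealSubfield L)) L (IsCMField.complexConj L) 3 (Matrix.diagonal α))]
    (z₁ : {w : InfinitePlace L // IsComplex w} → Fin 3 → Circle) (h02 : ∀ w, z₁ w 0 = z₁ w 2) (h01 : ∀ w, z₁ w 0 ≠ z₁ w 1)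
    [iR : ∀ (w : {w : InfinitePlace L // IsComplex w}) (τ : Perm (Fin 3)),
      MeasurableSpace (archLocal L 3 (Matrix.diagonal (α ∘ ⇑τ)) w ⧸ Subgroup.centralizer ({(⟨circleDiagonal 3 (z₁ w), circleDiagonal_mem_archLocal_diagonal L 3 (α ∘ ⇑τ) w (z₁ w)⟩ : archLocal L 3 (Matrix.diagonal (α ∘ ⇑τ)) w)} : Set (archLocal L 3 (Matrix.diagonal (α ∘ ⇑τ)) w)))]
    [iRb : ∀ (w : {w : InfinitePlace L // IsComplex w}) (τ : Perm (Fin 3)),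
      BorelSpace (archLocal L 3 (Matrix.diagonal (α ∘ ⇑τ)) w ⧸ Subgroup.centralizer ({(⟨circleDiagonal 3 (z₁ w), circleDiagonal_mem_archLocal_diagonal L 3 (α ∘ ⇑τ) w (z₁ w)⟩ : archLocal L 3 (Matrix.diagonal (α ∘ ⇑τ)) w)} : Set (archLocal L 3 (Matrix.diagonal (α ∘ ⇑τ)) w)))]
    -- (U2) per-place block measures and the factorisation of the block top-form measures
    (μ2 : ∀ (J : Matrix (Fin 2) (Fin 2) L) (w : {w : InfinitePlace L // IsComplex w}), Measure (archLocal L 2 J w)) [∀ J w, SigmaFinite (μ2 J w)]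
    (μ1 : ∀ (J : Matrix (Fin 1) (Fin 1) L) (w : {w : InfinitePlace L // IsComplex w}), Measure (archLocal L 1 J w)) [∀ J w, SigmaFinite (μ1 J w)]
    (hfac2 : ∀ (J : Matrix (Fin 2) (Fin 2) L), (J.map (IsCMField.complexConj L))ᵀ = J → IsUnit J.det →
      ∀ [MeasurableSpace (arch (↥(maximalRealSubfield L)) L (IsCMField.complexConj L) 2 J)] [BorelSpace (arch (↥(maximalRealSubfield L)) L (IsCMField.complexConj L) 2 J)]
        [MeasurableSpace (archSkew (↥(maximalRealSubfield L)) L (IsCMField.complexConj L) 2 J)] [BorelSpace (archSkew (↥(maximalRealSubfield L)) L (IsCMField.complexConj L) 2 J)],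
        (archTopFormHaar (↥(maximalRealSubfield L)) L (IsCMField.complexConj L) 2 J).map (archPiEquivCM 2 L J) = Measure.pi (μ2 J))
    (hfac1 : ∀ (J : Matrix (Fin 1) (Fin 1) L), (J.map (IsCMField.complexConj L))ᵀ = J → IsUnit J.det →
      ∀ [MeasurableSpace (arch (↥(maximalRealSubfield L)) L (IsCMField.complexConj L) 1 J)] [BorelSpace (arch (↥(maximalRealSubfield L)) L (IsCMField.complexConj L) 1 J)]
        [MeasurableSpace (archSkew (↥(maximalRealSubfield L)) L (IsCMField.complexConj L) 1 J)] [BorelSpace (archSkew (↥(maximalRealSubfield L)) L (IsCMField.complexConj L) 1 J)],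
        (archTopFormHaar (↥(maximalRealSubfield L)) L (IsCMField.complexConj L) 1 J).map (archPiEquivCM 1 L J) = Measure.pi (μ1 J))
    -- the block volumes at compact places
    (V₂ V₁ : ℝ≥0) (hV₂ : V₂ ≠ 0) (hV₁ : V₁ ≠ 0)
    (hvol2 : ∀ (H : Matrix (Fin 2) (Fin 2) L) (w : {w : InfinitePlace L // IsComplex w}), (H.map (IsCMField.complexConj L))ᵀ = H → IsUnit H.det →
      CompactSpace (archLocal L 2 H w) → (μ2 H w).IsHaarMeasure ∧ μ2 H w Set.univ = V₂)
    (hvol1 : ∀ (H : Matrix (Fin 1) (Fin 1) L) (w : {w : InfinitePlace L // IsComplex w}), (H.map (IsCMField.complexConj L))ᵀ = H → IsUnit H.det →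
      CompactSpace (archLocal L 1 H w) → (μ1 H w).IsHaarMeasure ∧ μ1 H w Set.univ = V₁)
    -- (HN) noncompact wall places: the local frame measure is `M •` the pinned transport, for every `(−1)`-pinned Haar family
    (hN : ∀ (νH : ∀ (w : {w : InfinitePlace L // IsComplex w}) (τ : Perm (Fin 3)), Measure (Subgroup.centralizer ({(⟨circleDiagonal 3 (z₁ w), circleDiagonal_mem_archLocal_diagonal L 3 (α ∘ ⇑τ) w (z₁ w)⟩ : archLocal L 3 (Matrix.diagonal (α ∘ ⇑τ)) w)} : Set (archLocal L 3 (Matrix.diagonal (α ∘ ⇑τ)) w))))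
        (hνH : ∀ w τ, (νH w τ).IsHaarMeasure ∧ (νH w τ).IsInvInvariant)
        (hpin : ∀ (w : {w : InfinitePlace L // IsComplex w}) (τ : Perm (Fin 3)), (w.1.embedding (α (τ 0))).re * (w.1.embedding (α (τ 2))).re < 0 →
        haveI : LocallyCompactSpace (archLocal L 3 (Matrix.diagonal (α ∘ ⇑τ)) w) := locallyCompactSpace_archLocal L 3 (Matrix.diagonal (α ∘ ⇑τ)) w
        haveI : SecondCountableTopology (archLocal L 3 (Matrix.diagonal (α ∘ ⇑τ)) w) := secondCountableTopology_archLocal L 3 (Matrix.diagonal (α ∘ ⇑τ)) w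
        haveI : (νH w τ).IsHaarMeasure := (hνH w τ).1
        haveI : (νH w τ).IsInvInvariant := (hνH w τ).2
        ∃ (ν : Measure (archLocal L 3 (Matrix.diagonal (α ∘ ⇑τ)) w)) (_ : ν.IsHaarMeasure) (_ : ν.IsMulRightInvariant),
          ∀ (Θ : Matrix (Fin 3) (Fin 3) ℂ → ℂ), ContDiff ℝ (⊤ : ℕ∞) Θ →
            HasCompactSupport (fun k : archLocal L 3 (Matrix.diagonal (α ∘ ⇑τ)) w => Θ ((k : GL (Fin 3) ℂ) : Matrix (Fin 3) (Fin 3) ℂ)) →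
            ∀ (z₀ : Fin 3 → Circle) (h02' : z₀ 0 = z₀ 2) (h01' : z₀ 0 ≠ z₀ 1),
              Tendsto (fun ψ : ℝ => deriv (fun ψ : ℝ => (2 * Real.sin ψ : ℂ) *
                  ∫ g, Θ (((g * ⟨circleDiagonal 3 (fun i => z₀ i * Circle.exp (![(1 : ℝ), 0, -1] i * ψ)),
                    circleDiagonal_mem_archLocal_diagonal L 3 (α ∘ ⇑τ) w _⟩ * g⁻¹ : archLocal L 3 (Matrix.diagonal (α ∘ ⇑τ)) w) : GL (Fin 3) ℂ) : Matrix (Fin 3) (Fin 3) ℂ) ∂(ν)) ψ)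
                (𝓝[≠] 0)
                (𝓝 ((-1 : ℂ) * ∫ y, descConj (⟨circleDiagonal 3 z₀, circleDiagonal_mem_archLocal_diagonal L 3 (α ∘ ⇑τ) w z₀⟩ : archLocal L 3 (Matrix.diagonal (α ∘ ⇑τ)) w)
                  (Subgroup.centralizer ({(⟨circleDiagonal 3 (z₁ w), circleDiagonal_mem_archLocal_diagonal L 3 (α ∘ ⇑τ) w (z₁ w)⟩ : archLocal L 3 (Matrix.diagonal (α ∘ ⇑τ)) w)} : Set (archLocal L 3 (Matrix.diagonal (α ∘ ⇑τ)) w)))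
                  (forall_mem_centralizer_circleDiagonal_comm_of_wall L (α ∘ ⇑τ) w (h02 w) (h01 w) h02' h01')
                  (fun k : archLocal L 3 (Matrix.diagonal (α ∘ ⇑τ)) w => Θ ((k : GL (Fin 3) ℂ) : Matrix (Fin 3) (Fin 3) ℂ)) y
                  ∂(quotientMeasure _ (νH w τ) (isClosed_coe_centralizer_singleton _) (ν))))),
      ∀ (z : {w : InfinitePlace L // IsComplex w} → Fin 3 → Circle) (hwall : ∀ w, z w 0 = z w 2 ∧ z w 0 ≠ z w 1)
        (_hrat : ∃ a b : L, ∀ w : {w : InfinitePlace L // IsComplex w}, ((z w 0 : ℂ) = w.1.embedding a) ∧ ((z w 1 : ℂ) = w.1.embedding b))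
        (ρ : {w : InfinitePlace L // IsComplex w} → Perm (Fin 3)) (w : {w : InfinitePlace L // IsComplex w}),
        ¬ 0 < (w.1.embedding (α ((ρ w)⁻¹ 0))).re * (w.1.embedding (α ((ρ w)⁻¹ 2))).re →
        ∀ (a b : L) (T : GL (Fin 3) (mixedSpace L)) (H_a : Matrix (Fin 2) (Fin 2) L) (H_b : Matrix (Fin 1) (Fin 1) L)
          (hf : IsSingularArchFrame L (Matrix.diagonal α) (archDiagTorus L 3 α (fun w => z w ∘ ⇑(ρ w))) a b T H_a H_b),
          ((μ2 H_a w).prod (μ1 H_b w)).map (fun u : archLocal L 2 H_a w × archLocal L 1 H_b w =>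
            (⟨⟨Matrix.GeneralLinearGroup.map (evalC L w) T *
                ((blockDiagFin (starRingEnd ℂ) (H_a.map w.1.embedding) (H_b.map w.1.embedding) u : unitaryGroupOfForm (starRingEnd ℂ) (finSum 2 1 (H_a.map w.1.embedding) (H_b.map w.1.embedding))) : GL (Fin (2 + 1)) ℂ) *
                (Matrix.GeneralLinearGroup.map (evalC L w) T)⁻¹, conj_blockDiagFin_mem_archLocal L w (formCongr_map_evalC_of_formCongr_archFormOf L hf.formCongr_eq w) u⟩,
              conj_blockDiagFin_mem_centralizer L w (formCongr_map_evalC_of_formCongr_archFormOf L hf.formCongr_eq w) (⟨circleDiagonal 3 (z w ∘ ⇑(ρ w)), circleDiagonal_mem_archLocal_diagonal L 3 α w (z w ∘ ⇑(ρ w))⟩ : archLocal L 3 (Matrix.diagonal α) w)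
                (by rw [coe_eq_map_evalC_of_archPiEquivCM_symm_eq L (archPiEquivCM_symm_circleDiagonal_eq_archDiagTorus L 3 α (fun w => z w ∘ ⇑(ρ w))) w]; exact mul_eq_map_evalC_of_mul_eq L hf.mul_eq w) u⟩ :
              Subgroup.centralizer ({(⟨circleDiagonal 3 (z w ∘ ⇑(ρ w)), circleDiagonal_mem_archLocal_diagonal L 3 α w (z w ∘ ⇑(ρ w))⟩ : archLocal L 3 (Matrix.diagonal α) w)} : Set (archLocal L 3 (Matrix.diagonal α) w)))) =
          (V₂ * V₁) • (νH w (ρ w)⁻¹).map (subgroupCongrHomeomorph (ContinuousMulEquiv.restrictSubgroup (GLn.conjEquiv (Matrix.GeneralLinearGroup.mkOfDetNeZero _ (det_monomial_one_ne_zero 3 (ρ w)⁻¹))) (archLocal L 3 (Matrix.diagonal (α ∘ ⇑(ρ w)⁻¹)) w) (archLocal L 3 (Matrix.diagonal α) w) (mem_archLocal_comp_perm_iff_conj_mem L 3 α w (ρ w)⁻¹)).toMulEquiv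
        (Subgroup.centralizer ({(⟨circleDiagonal 3 (z₁ w), circleDiagonal_mem_archLocal_diagonal L 3 (α ∘ ⇑(ρ w)⁻¹) w (z₁ w)⟩ : archLocal L 3 (Matrix.diagonal (α ∘ ⇑(ρ w)⁻¹)) w)} : Set (archLocal L 3 (Matrix.diagonal (α ∘ ⇑(ρ w)⁻¹)) w)))
        (Subgroup.centralizer ({(⟨circleDiagonal 3 (z w ∘ ⇑(ρ w)), circleDiagonal_mem_archLocal_diagonal L 3 α w (z w ∘ ⇑(ρ w))⟩ : archLocal L 3 (Matrix.diagonal α) w)} : Set (archLocal L 3 (Matrix.diagonal α) w)))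
        (relabel_inv_mem_centralizer_circleDiagonal_comp_iff L α w (ρ w) (h02 w) (h01 w) (hwall w).1 (hwall w).2)
        (ContinuousMulEquiv.restrictSubgroup (GLn.conjEquiv (Matrix.GeneralLinearGroup.mkOfDetNeZero _ (det_monomial_one_ne_zero 3 (ρ w)⁻¹))) (archLocal L 3 (Matrix.diagonal (α ∘ ⇑(ρ w)⁻¹)) w) (archLocal L 3 (Matrix.diagonal α) w) (mem_archLocal_comp_perm_iff_conj_mem L 3 α w (ρ w)⁻¹)).continuous
        (ContinuousMulEquiv.restrictSubgroup (GLn.conjEquiv (Matrix.GeneralLinearGroup.mkOfDetNeZero _ (det_monomial_one_ne_zero 3 (ρ w)⁻¹))) (archLocal L 3 (Matrix.diagonal (α ∘ ⇑(ρ w)⁻¹)) w) (archLocal L 3 (Matrix.diagonal α) w) (mem_archLocal_comp_perm_iff_conj_mem L 3 α w (ρ w)⁻¹)).symm.continuous)) :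
    ∃ K : ℝ≥0, K ≠ 0 ∧
      ∀ (νH : ∀ (w : {w : InfinitePlace L // IsComplex w}) (τ : Perm (Fin 3)), Measure (Subgroup.centralizer ({(⟨circleDiagonal 3 (z₁ w), circleDiagonal_mem_archLocal_diagonal L 3 (α ∘ ⇑τ) w (z₁ w)⟩ : archLocal L 3 (Matrix.diagonal (α ∘ ⇑τ)) w)} : Set (archLocal L 3 (Matrix.diagonal (α ∘ ⇑τ)) w))))
        (hνH : ∀ w τ, (νH w τ).IsHaarMeasure ∧ (νH w τ).IsInvInvariant)
        (hpin : ∀ (w : {w : InfinitePlace L // IsComplex w}) (τ : Perm (Fin 3)), (w.1.embedding (α (τ 0))).re * (w.1.embedding (α (τ 2))).re < 0 →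
        haveI : LocallyCompactSpace (archLocal L 3 (Matrix.diagonal (α ∘ ⇑τ)) w) := locallyCompactSpace_archLocal L 3 (Matrix.diagonal (α ∘ ⇑τ)) w
        haveI : SecondCountableTopology (archLocal L 3 (Matrix.diagonal (α ∘ ⇑τ)) w) := secondCountableTopology_archLocal L 3 (Matrix.diagonal (α ∘ ⇑τ)) w
        haveI : (νH w τ).IsHaarMeasure := (hνH w τ).1
        haveI : (νH w τ).IsInvInvariant := (hνH w τ).2
        ∃ (ν : Measure (archLocal L 3 (Matrix.diagonal (α ∘ ⇑τ)) w)) (_ : ν.IsHaarMeasure) (_ : ν.IsMulRightInvariant),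
          ∀ (Θ : Matrix (Fin 3) (Fin 3) ℂ → ℂ), ContDiff ℝ (⊤ : ℕ∞) Θ →
            HasCompactSupport (fun k : archLocal L 3 (Matrix.diagonal (α ∘ ⇑τ)) w => Θ ((k : GL (Fin 3) ℂ) : Matrix (Fin 3) (Fin 3) ℂ)) →
            ∀ (z₀ : Fin 3 → Circle) (h02' : z₀ 0 = z₀ 2) (h01' : z₀ 0 ≠ z₀ 1),
              Tendsto (fun ψ : ℝ => deriv (fun ψ : ℝ => (2 * Real.sin ψ : ℂ) *
                  ∫ g, Θ (((g * ⟨circleDiagonal 3 (fun i => z₀ i * Circle.exp (![(1 : ℝ), 0, -1] i * ψ)),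
                    circleDiagonal_mem_archLocal_diagonal L 3 (α ∘ ⇑τ) w _⟩ * g⁻¹ : archLocal L 3 (Matrix.diagonal (α ∘ ⇑τ)) w) : GL (Fin 3) ℂ) : Matrix (Fin 3) (Fin 3) ℂ) ∂(ν)) ψ)
                (𝓝[≠] 0)
                (𝓝 ((-1 : ℂ) * ∫ y, descConj (⟨circleDiagonal 3 z₀, circleDiagonal_mem_archLocal_diagonal L 3 (α ∘ ⇑τ) w z₀⟩ : archLocal L 3 (Matrix.diagonal (α ∘ ⇑τ)) w)
                  (Subgroup.centralizer ({(⟨circleDiagonal 3 (z₁ w), circleDiagonal_mem_archLocal_diagonal L 3 (α ∘ ⇑τ) w (z₁ w)⟩ : archLocal L 3 (Matrix.diagonal (α ∘ ⇑τ)) w)} : Set (archLocal L 3 (Matrix.diagonal (α ∘ ⇑τ)) w)))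
                  (forall_mem_centralizer_circleDiagonal_comm_of_wall L (α ∘ ⇑τ) w (h02 w) (h01 w) h02' h01')
                  (fun k : archLocal L 3 (Matrix.diagonal (α ∘ ⇑τ)) w => Θ ((k : GL (Fin 3) ℂ) : Matrix (Fin 3) (Fin 3) ℂ)) y
                  ∂(quotientMeasure _ (νH w τ) (isClosed_coe_centralizer_singleton _) (ν)))))
        (z : {w : InfinitePlace L // IsComplex w} → Fin 3 → Circle) (hwall : ∀ w, z w 0 = z w 2 ∧ z w 0 ≠ z w 1)
        (hrat : ∃ a b : L, ∀ w : {w : InfinitePlace L // IsComplex w}, ((z w 0 : ℂ) = w.1.embedding a) ∧ ((z w 1 : ℂ) = w.1.embedding b))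
        (ρ : {w : InfinitePlace L // IsComplex w} → Perm (Fin 3))
        (ρZ : ∀ (w : {w : InfinitePlace L // IsComplex w}) (σ : Perm (Fin 3)), Measure (Subgroup.centralizer ({(⟨circleDiagonal 3 (z w ∘ ⇑σ), circleDiagonal_mem_archLocal_diagonal L 3 α w (z w ∘ ⇑σ)⟩ : archLocal L 3 (Matrix.diagonal α) w)} : Set (archLocal L 3 (Matrix.diagonal α) w))))
        (hρZi : ∀ w σ, (ρZ w σ).IsHaarMeasure ∧ (ρZ w σ).IsInvInvariant)
        (hρZ : ∀ (w : {w : InfinitePlace L // IsComplex w}) (σ : Perm (Fin 3)), ¬ 0 < (w.1.embedding (α (σ⁻¹ 0))).re * (w.1.embedding (α (σ⁻¹ 2))).re →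
          ρZ w σ = (νH w σ⁻¹).map (subgroupCongrHomeomorph (ContinuousMulEquiv.restrictSubgroup (GLn.conjEquiv (Matrix.GeneralLinearGroup.mkOfDetNeZero _ (det_monomial_one_ne_zero 3 σ⁻¹))) (archLocal L 3 (Matrix.diagonal (α ∘ ⇑σ⁻¹)) w) (archLocal L 3 (Matrix.diagonal α) w) (mem_archLocal_comp_perm_iff_conj_mem L 3 α w σ⁻¹)).toMulEquiv
        (Subgroup.centralizer ({(⟨circleDiagonal 3 (z₁ w), circleDiagonal_mem_archLocal_diagonal L 3 (α ∘ ⇑σ⁻¹) w (z₁ w)⟩ : archLocal L 3 (Matrix.diagonal (α ∘ ⇑σ⁻¹)) w)} : Set (archLocal L 3 (Matrix.diagonal (α ∘ ⇑σ⁻¹)) w)))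
        (Subgroup.centralizer ({(⟨circleDiagonal 3 (z w ∘ ⇑σ), circleDiagonal_mem_archLocal_diagonal L 3 α w (z w ∘ ⇑σ)⟩ : archLocal L 3 (Matrix.diagonal α) w)} : Set (archLocal L 3 (Matrix.diagonal α) w)))
        (relabel_inv_mem_centralizer_circleDiagonal_comp_iff L α w σ (h02 w) (h01 w) (hwall w).1 (hwall w).2)
        (ContinuousMulEquiv.restrictSubgroup (GLn.conjEquiv (Matrix.GeneralLinearGroup.mkOfDetNeZero _ (det_monomial_one_ne_zero 3 σ⁻¹))) (archLocal L 3 (Matrix.diagonal (α ∘ ⇑σ⁻¹)) w) (archLocal L 3 (Matrix.diagonal α) w) (mem_archLocal_comp_perm_iff_conj_mem L 3 α w σ⁻¹)).continuous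
        (ContinuousMulEquiv.restrictSubgroup (GLn.conjEquiv (Matrix.GeneralLinearGroup.mkOfDetNeZero _ (det_monomial_one_ne_zero 3 σ⁻¹))) (archLocal L 3 (Matrix.diagonal (α ∘ ⇑σ⁻¹)) w) (archLocal L 3 (Matrix.diagonal α) w) (mem_archLocal_comp_perm_iff_conj_mem L 3 α w σ⁻¹)).symm.continuous))
        (hρZ1 : ∀ (w : {w : InfinitePlace L // IsComplex w}) (σ : Perm (Fin 3)), 0 < (w.1.embedding (α (σ⁻¹ 0))).re * (w.1.embedding (α (σ⁻¹ 2))).re → ρZ w σ Set.univ = 1)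
        (ρP : Measure (Subgroup.pi Set.univ (fun w : {w : InfinitePlace L // IsComplex w} => Subgroup.centralizer ({(⟨circleDiagonal 3 (z w ∘ ⇑(ρ w)), circleDiagonal_mem_archLocal_diagonal L 3 α w (z w ∘ ⇑(ρ w))⟩ : archLocal L 3 (Matrix.diagonal α) w)} : Set (archLocal L 3 (Matrix.diagonal α) w)))))
        (hρP : Measure.map (subgroupPiCoords fun w : {w : InfinitePlace L // IsComplex w} => Subgroup.centralizer ({(⟨circleDiagonal 3 (z w ∘ ⇑(ρ w)), circleDiagonal_mem_archLocal_diagonal L 3 α w (z w ∘ ⇑(ρ w))⟩ : archLocal L 3 (Matrix.diagonal α) w)} : Set (archLocal L 3 (Matrix.diagonal α) w))) ρP = Measure.pi fun w => ρZ w (ρ w))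
        (ρ' : Measure (Subgroup.centralizer ({archDiagTorus L 3 α (fun w => z w ∘ ⇑(ρ w))} : Set (arch (↥(maximalRealSubfield L)) L (IsCMField.complexConj L) 3 (Matrix.diagonal α)))))
        (hρ' : ρ' = ρP.map (subgroupCongrHomeomorph (archPiEquivCM 3 L (Matrix.diagonal α)).symm.toMulEquiv (Subgroup.pi Set.univ (fun w : {w : InfinitePlace L // IsComplex w} => Subgroup.centralizer ({(⟨circleDiagonal 3 (z w ∘ ⇑(ρ w)), circleDiagonal_mem_archLocal_diagonal L 3 α w (z w ∘ ⇑(ρ w))⟩ : archLocal L 3 (Matrix.diagonal α) w)} : Set (archLocal L 3 (Matrix.diagonal α) w)))) (Subgroup.centralizer ({archDiagTorus L 3 α (fun w => z w ∘ ⇑(ρ w))} : Set (arch (↥(maximalRealSubfield L)) L (IsCMField.complexConj L) 3 (Matrix.diagonal α)))) (apply_mem_centralizer_iff_mem_pi_centralizer _ (archPiEquivCM 3 L (Matrix.diagonal α)).symm.toMulEquiv (archPiEquivCM_symm_circleDiagonal_eq_archDiagTorus L 3 α (fun w => z w ∘ ⇑(ρ w)))) (archPiEquivCM 3 L (Matrix.diagonal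 α)).symm.continuous (archPiEquivCM 3 L (Matrix.diagonal α)).continuous)),
        centralizerTopFormHaar L (Matrix.diagonal α) (archDiagTorus L 3 α (fun w => z w ∘ ⇑(ρ w))) = K • ρ' := by
  classical
  refine exists_universalPinRatio_of_localData L α hα hherm z₁ h02 h01 μ2 μ1 hfac2 hfac1 (V₂ * V₁) (mul_ne_zero hV₂ hV₁) ?_ hN
  intro z hwall hrat ρ w hs a b T H_a H_b hf
  have hreal : ∀ i : Fin 3, (w.1.embedding (α i)).im = 0 := im_embedding_diagonal_eq_zero L 3 α hherm w
  -- the local frame data at `w`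
  have hTw := formCongr_map_evalC_of_formCongr_archFormOf L hf.formCongr_eq w
  have hγw : (((⟨circleDiagonal 3 (z w ∘ ⇑(ρ w)), circleDiagonal_mem_archLocal_diagonal L 3 α w (z w ∘ ⇑(ρ w))⟩ : archLocal L 3 (Matrix.diagonal α) w) : GL (Fin 3) ℂ) :
        Matrix (Fin 3) (Fin 3) ℂ) * ((Matrix.GeneralLinearGroup.map (evalC L w) T : GL (Fin 3) ℂ) : Matrix (Fin 3) (Fin 3) ℂ) =
      ((Matrix.GeneralLinearGroup.map (evalC L w) T : GL (Fin 3) ℂ) : Matrix (Fin 3) (Fin 3) ℂ) *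
        finSum 2 1 (evalC L w (mixedEmbedding L a) • (1 : Matrix (Fin 2) (Fin 2) ℂ)) (evalC L w (mixedEmbedding L b) • 1) := by
    rw [coe_eq_map_evalC_of_archPiEquivCM_symm_eq L (archPiEquivCM_symm_circleDiagonal_eq_archDiagTorus L 3 α (fun w => z w ∘ ⇑(ρ w))) w]
    exact mul_eq_map_evalC_of_mul_eq (N₁ := 2) (N₂ := 1) L hf.mul_eq w
  have hab : evalC L w (mixedEmbedding L a) ≠ evalC L w (mixedEmbedding L b) := by
    rw [evalC_apply, evalC_apply, mixedEmbedding_apply_isComplex, mixedEmbedding_apply_isComplex]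
    exact fun h => hf.1 (w.1.embedding.injective h)
  -- `Z(γ_w)` is compact at the compact wall place, hence so are both blocks
  haveI hZc : CompactSpace (Subgroup.centralizer
      ({(⟨circleDiagonal 3 (z w ∘ ⇑(ρ w)), circleDiagonal_mem_archLocal_diagonal L 3 α w (z w ∘ ⇑(ρ w))⟩ : archLocal L 3 (Matrix.diagonal α) w)} : Set (archLocal L 3 (Matrix.diagonal α) w))) :=
    isCompact_iff_compactSpace.mp (isCompact_centralizer_circleDiagonal_comp_of_pos L α w hα hreal (ρ w) hs (hwall w).1 (hwall w).2)
  obtain ⟨e, he⟩ := exists_continuousMulEquiv_localFrame (N₁ := 2) (N₂ := 1) (J := Matrix.diagonal α) (J₁ := H_a) (J₂ := H_b) L w hTw _ hγw hab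
  haveI : CompactSpace (archLocal L 2 H_a w × archLocal L 1 H_b w) := e.toHomeomorph.symm.compactSpace
  haveI : CompactSpace (archLocal L 2 H_a w) := compactSpace_of_prod_left (Y := archLocal L 1 H_b w)
  haveI : CompactSpace (archLocal L 1 H_b w) := compactSpace_of_prod_right (X := archLocal L 2 H_a w)
  obtain ⟨h2H, h2V⟩ := hvol2 H_a w hf.2.1 hf.2.2.2.1 inferInstance
  obtain ⟨h1H, h1V⟩ := hvol1 H_b w hf.2.2.1 hf.2.2.2.2.1 inferInstance
  haveI := h2H
  haveI := h1H
  refine ⟨isHaarMeasure_map_localFrame (N₁ := 2) (N₂ := 1) (J := Matrix.diagonal α) (J₁ := H_a) (J₂ := H_b) L w hTw _ hγw hab (μ2 H_a w) (μ1 H_b w), ?_⟩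
  rw [map_localFrame_apply_univ (N₁ := 2) (N₂ := 1) (J := Matrix.diagonal α) (J₁ := H_a) (J₂ := H_b) L w hTw _ hγw (μ2 H_a w) (μ1 H_b w), h2V, h1V, ENNReal.coe_mul]

end Literature.NumberTheory.Rogawski1990

end
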